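import Summits.QuantumFields.BalabanUV.Beta.EriceRemainderEnclosureHistoryAutonomyComparisonDefectOscillation

/-!
# EriceRemainderEnclosureHistoryAutonomyComparisonDefectAbove — (E140e) **THE MIRROR: A STRUCTURED MEMORY ABOVE AN ARBITRARY FUNCTIONAL.**  All comparison files of
# the column so far put the structured memory `B` (isotone, floor, zeroth moment, level-Lipschitz age profile) BELOW the arbitrary functional `B′` and conclude
# `h′ ≤ h`.  For a two-sided ENCLOSURE of an arbitrary perturbation one also needs the other side: `B′ ≤ B` with `B` structured ⟹ `h ≤ h′` (up to the defect ∕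
# oscillation of the DEFICIT `D = B − B′ ≥ 0`).  This file proves it by the observation that (E140a)∕(E140c)'s SEQUENCE contraction is invariant under
# `(X, E) ↦ (−X, −E)`: with `X_n = 1∕h′_{n+1}² − 1∕(S h′_n)_1²` and the (now non-positive) source `E_n = −D(tail_{n+1}h′)`, the lower ∕ upper flow links of (E138b) swap
# roles and the deficit's defect `u ≤ v ⟹ D u ≤ (1+τ)·D v + δ` is exactly the quasi-monotonicity the contraction consumes.  RESULTS, for `B′ ≤ B ≤ β̄` on the box with a
# common floor `b ≤ B′`, `θ = Σ_k k·Λ_k < 1`, `(1+τ)θ ≤ 1`:  the dual steps satisfy **`X_n ≤ θδ∕(1−θ)`** (`dual_steps_above`); `δ = 0` ⟹ **`h ≤ h′` at every scale**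
# (`ge_of_deficit_defect`, via the mirror order lemma `cmp_of_dual_steps_nonpos`); in general **`1∕h′_j² ≤ 1∕h_j² + j·θδ∕(1−θ)`** (`level_surplus_le`) and
# **`h_j∕√(1+κ) ≤ h′_j`**, `κ = θδ∕((1−θ)b)` (`coupling_ratio_ge`).  With (E140c)∕(E140d) this gives the two-sided enclosure of (E140f).

Cell `pub-balaban`, β-function sub-cell, BINDER row D4 «RemainderConst leaves for Bałaban's split» (`HOME/BINDER-OWNERS.md`; owner lineage `b2b-balaban-beta-an4`;
this file by co-owner #2 lineage `b2b-balaban-beta-d4-p2`, generation 108), β-FLOW TEAM duty (1), FREEZE (0) honoured (def-free; (E140c) `violation_le_osc`, (E138a)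
`dual_step_eq_levels` ∕ `gap_le_sum_parts` ∕ `tail_graded` ∕ `level_ge_pin_add`, (E48a) `strictAnti_of_memFlow` ∕ `family_zero` ∕ `family_mem` ∕ `family_succ_eq` ∕
`le_of_pin_le`, (E39) `exists_memFlow_zm`, (E43b) `memFlow_unique_of_monotone_zm` BY NAME; nothing restated).

HONEST FRAMING (page 1, verbatim and binding).  *"Discharging BetaPertH makes Bałaban's UV stability UNCONDITIONAL — a real constructive-QFT result; it is
NOT the continuum limit and NOT the Clay problem."*  THIS FILE DISCHARGES NOTHING OF THE KIND.  Elementary real analysis about ABSTRACT functionals on a box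
]0,γ]^ℕ (node U2's `MemFlow` ∕ `SeqBox`) — hypotheses of a census, not facts: nothing about Bałaban's (1.22) limit functional is PRINTED in this form ([I] p. 298;
GAPS G-t4-U2-1∕-2) or asserted.  Row D4 class UNCHANGED (critical-path width 0; instance 0∕1; D4 DISCHARGE NO DATE).  NOT B12 Thm 2, NOT BetaPertH, NOT continuum YM,
NOT Clay.

WHAT IS PROVED ([folklore]; 0 `def`, 0 sorry).  §1 `flow_link_lower_above`, `flow_link_upper_above`, `flow_violation_bound_above`, `flow_deficit_le_above`.
§2 **`dual_steps_above`**.  §3 **`cmp_of_dual_steps_nonpos`** (mirror of (E132)).  §4 **`ge_of_deficit_defect`**, **`level_surplus_le`**, **`coupling_ratio_ge`**.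
-/

noncomputable section
open Finset Set

namespace Summit.QuantumFields.BalabanUV.Beta.EriceRemainderEnclosureHistoryAutonomyComparisonDefectAbove

open Literature.MathematicalPhysics.QuantumFieldTheory.Balaban1983to89
open Literature.MathematicalPhysics.QuantumFieldTheory.Balaban1983to89.T4BetaStationary
open Literature.MathematicalPhysics.QuantumFieldTheory.Balaban1983to89.T4BetaFlowWellPosed
open Summit.QuantumFields.BalabanUV.Beta.EriceRemainderEnclosureHistoryAutonomyOrder
  (strictAnti_of_memFlow family_zero family_mem family_succ_eq le_of_pin_le)
open Summit.QuantumFields.BalabanUV.Beta.EriceRemainderEnclosureHistoryAutonomyComparisonDualContractionLinks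
  (dual_step_eq_levels gap_le_sum_parts tail_graded level_ge_pin_add)
open Summit.QuantumFields.BalabanUV.Beta.EriceRemainderEnclosureHistoryAutonomyComparisonDefectOscillation (violation_le_osc)

variable {B B' : (ℕ → ℝ) → ℝ} {M γ b : ℝ} {S : ℝ → ℕ → ℝ} {h h' : ℕ → ℝ}

/-! ## §1 The flow links when the arbitrary functional is BELOW the structured one (common floor `b ≤ B′ ≤ B`) -/

/-- THE LOWER LINK, `B′` below: `E_n − X_n ≤ Σ_k Λ_k Σ_{l≤k} X⁺_{n+l}` with `E_n = (B′−B)(tail_{n+1}h′) ≤ 0`, `X_n = 1∕h′_{n+1}² − 1∕(S h′_n)_1²` — (E138b)'s proof verbatim, the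
floor of `B′` now a hypothesis (it no longer follows from `B ≤ B′`). [folklore] -/
theorem flow_link_lower_above {Λ : ℕ → ℝ} {K : ℕ} (hb : 0 < b)
    (hmono : ∀ u v : ℕ → ℝ, SeqBox γ u → SeqBox γ v → (∀ i, u i ≤ v i) → B u ≤ B v)
    (hB : ∀ u u' : ℕ → ℝ, SeqBox γ u → SeqBox γ u' → ∀ D : ℝ, (∀ j, |u j - u' j| ≤ D) → |B u - B u'| ≤ M * D) (hM : 0 ≤ M)
    (hlo : ∀ u, SeqBox γ u → b ≤ B u) (hlo' : ∀ u, SeqBox γ u → b ≤ B' u)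
    (hS : ∀ p, 0 < p → p ≤ γ → SeqBox γ (S p) ∧ MemFlow B p (S p))
    (huniq : ∀ p, 0 < p → p ≤ γ → ∀ u u' : ℕ → ℝ, SeqBox γ u → SeqBox γ u' → MemFlow B p u → MemFlow B p u' → u = u')
    (hΛ : ∀ k, 0 ≤ Λ k)
    (hLip : ∀ u v : ℕ → ℝ, SeqBox γ u → SeqBox γ v → (∀ k : ℕ, 1 / γ ^ 2 + ((k : ℝ) + 1) * b ≤ 1 / u k ^ 2) →
      (∀ k : ℕ, 1 / γ ^ 2 + ((k : ℝ) + 1) * b ≤ 1 / v k ^ 2) → B u - B v ≤ ∑ k ∈ range K, Λ k * max (1 / v k ^ 2 - 1 / u k ^ 2) 0)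
    (hh' : SeqBox γ h') {y : ℝ} (hy : 0 < y) (hyγ : y ≤ γ) (hf' : MemFlow B' y h') (n : ℕ) :
    (B' (fun i => h' (n + 1 + i)) - B (fun i => h' (n + 1 + i))) - (1 / h' (n + 1) ^ 2 - 1 / S (h' n) 1 ^ 2)
      ≤ ∑ k ∈ range K, Λ k * ∑ l ∈ range (k + 1), max (1 / h' (n + l + 1) ^ 2 - 1 / S (h' (n + l)) 1 ^ 2) 0 := by
  have hpn := hh' n
  have hSn := hS (h' n) hpn.1 hpn.2
  have hu : SeqBox γ (fun i => S (h' n) (1 + i)) := fun i => hSn.1 (1 + i)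
  have hv : SeqBox γ (fun i => h' (n + 1 + i)) := fun i => hh' (n + 1 + i)
  have hgu : ∀ k : ℕ, 1 / γ ^ 2 + ((k : ℝ) + 1) * b ≤ 1 / (fun i => S (h' n) (1 + i)) k ^ 2 := by
    intro k
    have := tail_graded hb hlo hSn.1 hpn.1 hpn.2 hSn.2 0 k
    simpa only [zero_add] using this
  have hgv : ∀ k : ℕ, 1 / γ ^ 2 + ((k : ℝ) + 1) * b ≤ 1 / (fun i => h' (n + 1 + i)) k ^ 2 := fun k =>
    tail_graded hb hlo' hh' hy hyγ hf' n k
  have hdrop := hLip _ _ hu hv hgu hgv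
  beta_reduce at hdrop
  have heq := dual_step_eq_levels hS hh' hf' n
  have hsum : ∑ k ∈ range K, Λ k * max (1 / h' (n + 1 + k) ^ 2 - 1 / S (h' n) (1 + k) ^ 2) 0
      ≤ ∑ k ∈ range K, Λ k * ∑ l ∈ range (k + 1), max (1 / h' (n + l + 1) ^ 2 - 1 / S (h' (n + l)) 1 ^ 2) 0 :=
    sum_le_sum fun k _ => mul_le_mul_of_nonneg_left
      (max_le (gap_le_sum_parts hb hmono hB hM hlo hS huniq hh' k n).1 (sum_nonneg fun l _ => le_max_right _ _)) (hΛ k)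
  linarith [hdrop, heq, hsum]

/-- THE UPPER LINK, `B′` below: `X_n − E_n ≤ Σ_k Λ_k Σ_{l≤k} X⁻_{n+l}`. [folklore] -/
theorem flow_link_upper_above {Λ : ℕ → ℝ} {K : ℕ} (hb : 0 < b)
    (hmono : ∀ u v : ℕ → ℝ, SeqBox γ u → SeqBox γ v → (∀ i, u i ≤ v i) → B u ≤ B v)
    (hB : ∀ u u' : ℕ → ℝ, SeqBox γ u → SeqBox γ u' → ∀ D : ℝ, (∀ j, |u j - u' j| ≤ D) → |B u - B u'| ≤ M * D) (hM : 0 ≤ M)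
    (hlo : ∀ u, SeqBox γ u → b ≤ B u) (hlo' : ∀ u, SeqBox γ u → b ≤ B' u)
    (hS : ∀ p, 0 < p → p ≤ γ → SeqBox γ (S p) ∧ MemFlow B p (S p))
    (huniq : ∀ p, 0 < p → p ≤ γ → ∀ u u' : ℕ → ℝ, SeqBox γ u → SeqBox γ u' → MemFlow B p u → MemFlow B p u' → u = u')
    (hΛ : ∀ k, 0 ≤ Λ k)
    (hLip : ∀ u v : ℕ → ℝ, SeqBox γ u → SeqBox γ v → (∀ k : ℕ, 1 / γ ^ 2 + ((k : ℝ) + 1) * b ≤ 1 / u k ^ 2) →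
      (∀ k : ℕ, 1 / γ ^ 2 + ((k : ℝ) + 1) * b ≤ 1 / v k ^ 2) → B u - B v ≤ ∑ k ∈ range K, Λ k * max (1 / v k ^ 2 - 1 / u k ^ 2) 0)
    (hh' : SeqBox γ h') {y : ℝ} (hy : 0 < y) (hyγ : y ≤ γ) (hf' : MemFlow B' y h') (n : ℕ) :
    (1 / h' (n + 1) ^ 2 - 1 / S (h' n) 1 ^ 2) - (B' (fun i => h' (n + 1 + i)) - B (fun i => h' (n + 1 + i)))
      ≤ ∑ k ∈ range K, Λ k * ∑ l ∈ range (k + 1), max (-(1 / h' (n + l + 1) ^ 2 - 1 / S (h' (n + l)) 1 ^ 2)) 0 := by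
  have hpn := hh' n
  have hSn := hS (h' n) hpn.1 hpn.2
  have hu : SeqBox γ (fun i => S (h' n) (1 + i)) := fun i => hSn.1 (1 + i)
  have hv : SeqBox γ (fun i => h' (n + 1 + i)) := fun i => hh' (n + 1 + i)
  have hgu : ∀ k : ℕ, 1 / γ ^ 2 + ((k : ℝ) + 1) * b ≤ 1 / (fun i => S (h' n) (1 + i)) k ^ 2 := by
    intro k
    have := tail_graded hb hlo hSn.1 hpn.1 hpn.2 hSn.2 0 k
    simpa only [zero_add] using this
  have hgv : ∀ k : ℕ, 1 / γ ^ 2 + ((k : ℝ) + 1) * b ≤ 1 / (fun i => h' (n + 1 + i)) k ^ 2 := fun k =>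
    tail_graded hb hlo' hh' hy hyγ hf' n k
  have hrise := hLip _ _ hv hu hgv hgu
  beta_reduce at hrise
  have heq := dual_step_eq_levels hS hh' hf' n
  have hsum : ∑ k ∈ range K, Λ k * max (1 / S (h' n) (1 + k) ^ 2 - 1 / h' (n + 1 + k) ^ 2) 0
      ≤ ∑ k ∈ range K, Λ k * ∑ l ∈ range (k + 1), max (-(1 / h' (n + l + 1) ^ 2 - 1 / S (h' (n + l)) 1 ^ 2)) 0 :=
    sum_le_sum fun k _ => mul_le_mul_of_nonneg_left
      (max_le (by linarith [(gap_le_sum_parts hb hmono hB hM hlo hS huniq hh' k n).2])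
        (sum_nonneg fun l _ => le_max_right _ _)) (hΛ k)
  linarith [hrise, heq, hsum]

/-- THE INITIAL BOUND, `B′` below: with `b ≤ B′ ≤ B ≤ β̄` on the box, `X⁺_m ≤ β̄` and `E_m − X_m ≤ β̄`. [folklore] -/
theorem flow_violation_bound_above {βb : ℝ} (hb : 0 < b) (hlo : ∀ u, SeqBox γ u → b ≤ B u) (hlo' : ∀ u, SeqBox γ u → b ≤ B' u)
    (hS : ∀ p, 0 < p → p ≤ γ → SeqBox γ (S p) ∧ MemFlow B p (S p))
    (hle : ∀ u, SeqBox γ u → B' u ≤ B u) (hbdd : ∀ u, SeqBox γ u → B u ≤ βb)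
    (hh' : SeqBox γ h') {y : ℝ} (hf' : MemFlow B' y h') (m : ℕ) :
    max (-(-(1 / h' (m + 1) ^ 2 - 1 / S (h' m) 1 ^ 2))) 0 ≤ βb
      ∧ -(1 / h' (m + 1) ^ 2 - 1 / S (h' m) 1 ^ 2) - (-(B' (fun i => h' (m + 1 + i)) - B (fun i => h' (m + 1 + i)))) ≤ βb := by
  have hu : SeqBox γ (fun i => S (h' m) (1 + i)) := fun i => (hS (h' m) (hh' m).1 (hh' m).2).1 (1 + i)
  have hv : SeqBox γ (fun i => h' (m + 1 + i)) := fun i => hh' (m + 1 + i)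
  have heq := dual_step_eq_levels hS hh' hf' m
  have h1 := hlo _ hu
  have h3 := hbdd _ hu
  have h4 := hlo' _ hv
  have h5 := hle _ hv
  have h6 := hbdd _ hv
  refine ⟨max_le (by linarith) (by linarith), by linarith⟩

/-- THE DEFICIT ALONG ONE ORBIT: `u ≤ v ⟹ (B−B′)u ≤ (1+τ)(B−B′)v + δ` on the box and `h′` a box solution of `B′` (floor `b > 0`) give
`D_{n+l+1} ≤ (1+τ)D_n + δ` for `D_n = (B−B′)(tail_{n+1}h′)`. [folklore] -/
theorem flow_deficit_le_above {τ δ : ℝ} (hb : 0 < b) (hlo' : ∀ u, SeqBox γ u → b ≤ B' u)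
    (hDdef : ∀ u v : ℕ → ℝ, SeqBox γ u → SeqBox γ v → (∀ i, u i ≤ v i) → B u - B' u ≤ (1 + τ) * (B v - B' v) + δ)
    (hh' : SeqBox γ h') {y : ℝ} (hf' : MemFlow B' y h') (n l : ℕ) :
    -(B' (fun i => h' (n + (l + 1) + 1 + i)) - B (fun i => h' (n + (l + 1) + 1 + i)))
      ≤ (1 + τ) * -(B' (fun i => h' (n + 1 + i)) - B (fun i => h' (n + 1 + i))) + δ := by
  have hanti := (strictAnti_of_memFlow hb hlo' hh' hf').antitone
  have := hDdef _ _ (fun i => hh' (n + (l + 1) + 1 + i)) (fun i => hh' (n + 1 + i)) fun i => hanti (by omega)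
  linarith

/-! ## §2 The dual steps are bounded ABOVE by `θδ∕(1−θ)` -/

/-- **THE DUAL STEPS OF AN ORBIT OF A FUNCTIONAL BELOW THE STRUCTURED MEMORY ARE `≤ θδ∕(1−θ)`** (and `≥ −D(tail) − θδ∕(1−θ)`).  Base `B`: isotone, modulus `M`, unique box
solutions `S q`, level-Lipschitz age profile `Λ ≥ 0` on the graded box (grading `b`), `θ = Σ_{k<K} k·Λ_k < 1`, `B ≤ β̄`.  Perturbed `B′`: `b ≤ B′ ≤ B` on the box (common floor
`b > 0`), deficit `D = B − B′` with `u ≤ v ⟹ D u ≤ (1+τ)·D v + δ` (`τ, δ ≥ 0`), `(1+τ)θ ≤ 1`; `h′` a box solution of `B′`.  Proof: (E140c) `violation_le_osc` applied to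
`(−X, −E)` — the links of §1 swap roles. [folklore] -/
theorem dual_steps_above {Λ : ℕ → ℝ} {K : ℕ} {βb τ δ : ℝ} (hb : 0 < b)
    (hmono : ∀ u v : ℕ → ℝ, SeqBox γ u → SeqBox γ v → (∀ i, u i ≤ v i) → B u ≤ B v)
    (hB : ∀ u u' : ℕ → ℝ, SeqBox γ u → SeqBox γ u' → ∀ D : ℝ, (∀ j, |u j - u' j| ≤ D) → |B u - B u'| ≤ M * D) (hM : 0 ≤ M)
    (hlo' : ∀ u, SeqBox γ u → b ≤ B' u) (hle : ∀ u, SeqBox γ u → B' u ≤ B u) (hbdd : ∀ u, SeqBox γ u → B u ≤ βb)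
    (hS : ∀ p, 0 < p → p ≤ γ → SeqBox γ (S p) ∧ MemFlow B p (S p))
    (huniq : ∀ p, 0 < p → p ≤ γ → ∀ u u' : ℕ → ℝ, SeqBox γ u → SeqBox γ u' → MemFlow B p u → MemFlow B p u' → u = u')
    (hΛ : ∀ k, 0 ≤ Λ k) (hθ : ∑ k ∈ range K, (k : ℝ) * Λ k < 1)
    (hτ : 0 ≤ τ) (hθτ : (1 + τ) * ∑ k ∈ range K, (k : ℝ) * Λ k ≤ 1) (hδ : 0 ≤ δ)
    (hLip : ∀ u v : ℕ → ℝ, SeqBox γ u → SeqBox γ v → (∀ k : ℕ, 1 / γ ^ 2 + ((k : ℝ) + 1) * b ≤ 1 / u k ^ 2) →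
      (∀ k : ℕ, 1 / γ ^ 2 + ((k : ℝ) + 1) * b ≤ 1 / v k ^ 2) → B u - B v ≤ ∑ k ∈ range K, Λ k * max (1 / v k ^ 2 - 1 / u k ^ 2) 0)
    (hDdef : ∀ u v : ℕ → ℝ, SeqBox γ u → SeqBox γ v → (∀ i, u i ≤ v i) → B u - B' u ≤ (1 + τ) * (B v - B' v) + δ)
    (hh' : SeqBox γ h') {y : ℝ} (hy : 0 < y) (hyγ : y ≤ γ) (hf' : MemFlow B' y h') (n : ℕ) :
    1 / h' (n + 1) ^ 2 - 1 / S (h' n) 1 ^ 2 ≤ (∑ k ∈ range K, (k : ℝ) * Λ k) * δ / (1 - ∑ k ∈ range K, (k : ℝ) * Λ k)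
      ∧ (B' (fun i => h' (n + 1 + i)) - B (fun i => h' (n + 1 + i)))
          - (∑ k ∈ range K, (k : ℝ) * Λ k) * δ / (1 - ∑ k ∈ range K, (k : ℝ) * Λ k) ≤ 1 / h' (n + 1) ^ 2 - 1 / S (h' n) 1 ^ 2 := by
  have hlo : ∀ u, SeqBox γ u → b ≤ B u := fun u hu => (hlo' u hu).trans (hle u hu)
  have key := violation_le_osc (X := fun m => -(1 / h' (m + 1) ^ 2 - 1 / S (h' m) 1 ^ 2))
    (E := fun m => -(B' (fun i => h' (m + 1 + i)) - B (fun i => h' (m + 1 + i)))) hΛ hθ hτ hθτ hδ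
    (fun m => by have := hle _ (fun i => hh' (m + 1 + i)); linarith)
    (fun m l => flow_deficit_le_above hb hlo' hDdef hh' hf' m l)
    (fun m => by
      have := flow_link_upper_above hb hmono hB hM hlo hlo' hS huniq hΛ hLip hh' hy hyγ hf' m
      linarith)
    (fun m => by
      have := flow_link_lower_above hb hmono hB hM hlo hlo' hS huniq hΛ hLip hh' hy hyγ hf' m
      have e : ∀ l, max (-(-(1 / h' (m + l + 1) ^ 2 - 1 / S (h' (m + l)) 1 ^ 2))) 0
          = max (1 / h' (m + l + 1) ^ 2 - 1 / S (h' (m + l)) 1 ^ 2) 0 := fun l => by rw [neg_neg]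
      simp only [e]
      linarith)
    (fun m => flow_violation_bound_above hb hlo hlo' hS hle hbdd hh' hf' m) n
  obtain ⟨k1, k2⟩ := key
  constructor
  · linarith
  · linarith

/-! ## §3 The mirror order lemma: non-positive dual steps put the perturbed orbit ABOVE the base orbit -/

/-- **COMPARISON FROM NON-POSITIVE DUAL STEP QUANTITIES** (mirror of (E132) `cmp_of_dual_steps_nonneg`).  Base `B`: floor `b > 0`, modulus `M`, a unique box solution `S p`
from every pin.  `B′` arbitrary; `h′` a box solution of `B′` from the pin `y`.  If `B′(h′_{j+1}, …) ≤ B((S h′_j)_1, …)` for `j < n` then `(S y)_j ≤ h′_j` for `j ≤ n`: at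
each row the perturbed level gains at most what the base restarted at the same pin gains, and the base's one-step map is monotone in the pin. [folklore] -/
theorem cmp_of_dual_steps_nonpos (hb : 0 < b)
    (hB : ∀ u u' : ℕ → ℝ, SeqBox γ u → SeqBox γ u' → ∀ D : ℝ, (∀ j, |u j - u' j| ≤ D) → |B u - B u'| ≤ M * D) (hM : 0 ≤ M)
    (hlo : ∀ u, SeqBox γ u → b ≤ B u)
    (hS : ∀ p, 0 < p → p ≤ γ → SeqBox γ (S p) ∧ MemFlow B p (S p))
    (huniq : ∀ p, 0 < p → p ≤ γ → ∀ u u' : ℕ → ℝ, SeqBox γ u → SeqBox γ u' → MemFlow B p u → MemFlow B p u' → u = u')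
    {y : ℝ} (hy : 0 < y) (hyγ : y ≤ γ) (hh' : SeqBox γ h') (hf' : MemFlow B' y h') (n : ℕ)
    (hX : ∀ j, j < n → B' (fun i => h' (j + 1 + i)) ≤ B (fun i => S (h' j) (1 + i))) :
    ∀ j, j ≤ n → S y j ≤ h' j := by
  intro j
  induction j with
  | zero => intro _; rw [hf'.1, family_zero hS hy hyγ]
  | succ j ih =>
    intro hj
    have hjn : j < n := by omega
    have hprev : S y j ≤ h' j := ih (by omega)
    have hpj : 0 < h' j := (hh' j).1
    have hpjγ : h' j ≤ γ := (hh' j).2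
    -- the base restarted at h′_j: its first step
    have hSj := hS (h' j) hpj hpjγ
    have hstep0 : 1 / S (h' j) (0 + 1) ^ 2 = 1 / S (h' j) 0 ^ 2 + B (fun i => S (h' j) (0 + 1 + i)) := hSj.2.2 0
    rw [family_zero hS hpj hpjγ, show (0 : ℕ) + 1 = 1 from rfl] at hstep0
    have e1 : (fun i => S (h' j) (0 + 1 + i)) = (fun i => S (h' j) (1 + i)) := by funext i; simp
    rw [e1] at hstep0
    -- the perturbed step
    have hstep' : 1 / h' (j + 1) ^ 2 = 1 / h' j ^ 2 + B' (fun i => h' (j + 1 + i)) := hf'.2 j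
    have hle1 : 1 / h' (j + 1) ^ 2 ≤ 1 / S (h' j) 1 ^ 2 := by rw [hstep0, hstep']; linarith [hX j hjn]
    -- base one-step monotonicity in the pin: S y (j+1) = S (S y j) 1 ≤ S (h′_j) 1
    have hqj := family_mem hS hy hyγ j
    have hmono1 : S (S y j) 1 ≤ S (h' j) 1 :=
      le_of_pin_le hb hB hM hlo huniq hqj.1 hprev hpjγ (hS _ hqj.1 hqj.2).1 hSj.1 (hS _ hqj.1 hqj.2).2 hSj.2 1
    rw [← family_succ_eq hS huniq hy hyγ j] at hmono1
    -- conclude from the levels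
    have hpos1 : 0 < h' (j + 1) := (hh' (j + 1)).1
    have hposS : 0 < S (h' j) 1 := (hSj.1 1).1
    have hposY : 0 < S y (j + 1) := ((hS y hy hyγ).1 (j + 1)).1
    have hlev : 1 / S (h' j) 1 ^ 2 ≤ 1 / S y (j + 1) ^ 2 :=
      one_div_le_one_div_of_le (pow_pos hposY 2) (pow_le_pow_left₀ hposY.le hmono1 2)
    have hfin : 1 / h' (j + 1) ^ 2 ≤ 1 / S y (j + 1) ^ 2 := hle1.trans hlev
    have hsq : S y (j + 1) ^ 2 ≤ h' (j + 1) ^ 2 := (one_div_le_one_div (pow_pos hpos1 2) (pow_pos hposY 2)).mp hfin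
    exact (pow_le_pow_iff_left₀ hposY.le hpos1.le two_ne_zero).mp hsq

/-! ## §4 The mirror theorems: exact order for `δ = 0`, bounded surplus and a scale-uniform ratio in general -/

/-- **A STRUCTURED MEMORY ABOVE: `B′ ≤ B ⟹ h ≤ h′` WHEN THE DEFICIT HAS DEFECT `τ` WITH `(1+τ)θ ≤ 1`.**  `B`: isotone on `]0,γ]^ℕ`, zeroth moment `M`, `B ≤ β̄`, level-Lipschitz
age profile `Λ ≥ 0` on the graded box (grading `b`), `θ = Σ_{k<K} k·Λ_k < 1`.  `B′`: ANY functional with `b ≤ B′ ≤ B` on the box (`b > 0`) whose deficit `D = B − B′` satisfies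
`u ≤ v ⟹ D u ≤ (1+τ)·D v`, `τ ≥ 0`, `(1+τ)θ ≤ 1`.  `h, h′`: ANY box solutions of `B, B′` from one pin.  Then **`h ≤ h′` at every scale**. [folklore] -/
theorem ge_of_deficit_defect {Λ : ℕ → ℝ} {K : ℕ} {βb p τ : ℝ}
    (hmono : ∀ u v : ℕ → ℝ, SeqBox γ u → SeqBox γ v → (∀ i, u i ≤ v i) → B u ≤ B v)
    (hB : ∀ u u' : ℕ → ℝ, SeqBox γ u → SeqBox γ u' → ∀ D : ℝ, (∀ j, |u j - u' j| ≤ D) → |B u - B u'| ≤ M * D) (hM : 0 ≤ M)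
    (hb : 0 < b) (hlo' : ∀ u, SeqBox γ u → b ≤ B' u) (hle : ∀ u, SeqBox γ u → B' u ≤ B u) (hbdd : ∀ u, SeqBox γ u → B u ≤ βb)
    (hΛ : ∀ k, 0 ≤ Λ k) (hθ : ∑ k ∈ range K, (k : ℝ) * Λ k < 1)
    (hτ : 0 ≤ τ) (hθτ : (1 + τ) * ∑ k ∈ range K, (k : ℝ) * Λ k ≤ 1)
    (hLip : ∀ u v : ℕ → ℝ, SeqBox γ u → SeqBox γ v → (∀ k : ℕ, 1 / γ ^ 2 + ((k : ℝ) + 1) * b ≤ 1 / u k ^ 2) →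
      (∀ k : ℕ, 1 / γ ^ 2 + ((k : ℝ) + 1) * b ≤ 1 / v k ^ 2) → B u - B v ≤ ∑ k ∈ range K, Λ k * max (1 / v k ^ 2 - 1 / u k ^ 2) 0)
    (hDdef : ∀ u v : ℕ → ℝ, SeqBox γ u → SeqBox γ v → (∀ i, u i ≤ v i) → B u - B' u ≤ (1 + τ) * (B v - B' v))
    (hp : 0 < p) (hpγ : p ≤ γ) (hh : SeqBox γ h) (hf : MemFlow B p h) (hh' : SeqBox γ h') (hf' : MemFlow B' p h') (j : ℕ) :
    h j ≤ h' j := by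
  have hlo : ∀ u, SeqBox γ u → b ≤ B u := fun u hu => (hlo' u hu).trans (hle u hu)
  -- the unique base family
  have hex : ∀ q : ℝ, 0 < q → q ≤ γ → ∃ k : ℕ → ℝ, SeqBox γ k ∧ MemFlow B q k :=
    fun q hq hqγ => Summit.QuantumFields.BalabanUV.Beta.EriceRemainderEnclosureHistoryAutonomyExistence.exists_memFlow_zm hB hM hq hqγ hb hlo
  choose! S hSb hSf using hex
  have hS : ∀ q, 0 < q → q ≤ γ → SeqBox γ (S q) ∧ MemFlow B q (S q) := fun q hq hqγ => ⟨hSb q hq hqγ, hSf q hq hqγ⟩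
  have huniq : ∀ q, 0 < q → q ≤ γ → ∀ u u' : ℕ → ℝ, SeqBox γ u → SeqBox γ u' → MemFlow B q u → MemFlow B q u' → u = u' :=
    fun q hq _ u u' hu hu' hfu hfu' =>
      Summit.QuantumFields.BalabanUV.Beta.EriceRemainderEnclosureHistoryAutonomyMonotoneGeneral.memFlow_unique_of_monotone_zm
        hmono hB hM hq hb hlo hu hu' hfu hfu'
  have e : h = S p := huniq p hp hpγ _ _ hh (hS p hp hpγ).1 hf (hS p hp hpγ).2
  rw [e]
  have hDdef' : ∀ u v : ℕ → ℝ, SeqBox γ u → SeqBox γ v → (∀ i, u i ≤ v i) → B u - B' u ≤ (1 + τ) * (B v - B' v) + 0 :=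
    fun u v hu hv huv => by linarith [hDdef u v hu hv huv]
  refine cmp_of_dual_steps_nonpos (B' := B') hb hB hM hlo hS huniq hp hpγ hh' hf' j (fun i _ => ?_) j le_rfl
  have h0 := (dual_steps_above hb hmono hB hM hlo' hle hbdd hS huniq hΛ hθ hτ hθτ le_rfl hLip hDdef' hh' hp hpγ hf' i).1
  have heq := dual_step_eq_levels hS hh' hf' i
  rw [mul_zero, zero_div] at h0
  linarith

/-- **THE LEVEL SURPLUS OF AN ORBIT BELOW A STRUCTURED MEMORY GROWS AT MOST LINEARLY: `1∕h′_j² ≤ 1∕h_j² + j·θδ∕(1−θ)`** — same data as `ge_of_deficit_defect` but the deficit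
may oscillate: `u ≤ v ⟹ D u ≤ (1+τ)·D v + δ`. [folklore] -/
theorem level_surplus_le {Λ : ℕ → ℝ} {K : ℕ} {βb p τ δ : ℝ}
    (hmono : ∀ u v : ℕ → ℝ, SeqBox γ u → SeqBox γ v → (∀ i, u i ≤ v i) → B u ≤ B v)
    (hB : ∀ u u' : ℕ → ℝ, SeqBox γ u → SeqBox γ u' → ∀ D : ℝ, (∀ j, |u j - u' j| ≤ D) → |B u - B u'| ≤ M * D) (hM : 0 ≤ M)
    (hb : 0 < b) (hlo' : ∀ u, SeqBox γ u → b ≤ B' u) (hle : ∀ u, SeqBox γ u → B' u ≤ B u) (hbdd : ∀ u, SeqBox γ u → B u ≤ βb)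
    (hΛ : ∀ k, 0 ≤ Λ k) (hθ : ∑ k ∈ range K, (k : ℝ) * Λ k < 1)
    (hτ : 0 ≤ τ) (hθτ : (1 + τ) * ∑ k ∈ range K, (k : ℝ) * Λ k ≤ 1) (hδ : 0 ≤ δ)
    (hLip : ∀ u v : ℕ → ℝ, SeqBox γ u → SeqBox γ v → (∀ k : ℕ, 1 / γ ^ 2 + ((k : ℝ) + 1) * b ≤ 1 / u k ^ 2) →
      (∀ k : ℕ, 1 / γ ^ 2 + ((k : ℝ) + 1) * b ≤ 1 / v k ^ 2) → B u - B v ≤ ∑ k ∈ range K, Λ k * max (1 / v k ^ 2 - 1 / u k ^ 2) 0)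
    (hDdef : ∀ u v : ℕ → ℝ, SeqBox γ u → SeqBox γ v → (∀ i, u i ≤ v i) → B u - B' u ≤ (1 + τ) * (B v - B' v) + δ)
    (hp : 0 < p) (hpγ : p ≤ γ) (hh : SeqBox γ h) (hf : MemFlow B p h) (hh' : SeqBox γ h') (hf' : MemFlow B' p h') (j : ℕ) :
    1 / h' j ^ 2 ≤ 1 / h j ^ 2 + (j : ℝ) * ((∑ k ∈ range K, (k : ℝ) * Λ k) * δ / (1 - ∑ k ∈ range K, (k : ℝ) * Λ k)) := by
  set F : ℝ := (∑ k ∈ range K, (k : ℝ) * Λ k) * δ / (1 - ∑ k ∈ range K, (k : ℝ) * Λ k) with hFdef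
  have hlo : ∀ u, SeqBox γ u → b ≤ B u := fun u hu => (hlo' u hu).trans (hle u hu)
  have hex : ∀ q : ℝ, 0 < q → q ≤ γ → ∃ k : ℕ → ℝ, SeqBox γ k ∧ MemFlow B q k :=
    fun q hq hqγ => Summit.QuantumFields.BalabanUV.Beta.EriceRemainderEnclosureHistoryAutonomyExistence.exists_memFlow_zm hB hM hq hqγ hb hlo
  choose! S hSb hSf using hex
  have hS : ∀ q, 0 < q → q ≤ γ → SeqBox γ (S q) ∧ MemFlow B q (S q) := fun q hq hqγ => ⟨hSb q hq hqγ, hSf q hq hqγ⟩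
  have huniq : ∀ q, 0 < q → q ≤ γ → ∀ u u' : ℕ → ℝ, SeqBox γ u → SeqBox γ u' → MemFlow B q u → MemFlow B q u' → u = u' :=
    fun q hq _ u u' hu hu' hfu hfu' =>
      Summit.QuantumFields.BalabanUV.Beta.EriceRemainderEnclosureHistoryAutonomyMonotoneGeneral.memFlow_unique_of_monotone_zm
        hmono hB hM hq hb hlo hu hu' hfu hfu'
  have e : h = S p := huniq p hp hpγ _ _ hh (hS p hp hpγ).1 hf (hS p hp hpγ).2
  rcases Nat.eq_zero_or_pos j with hj0 | hjpos
  · subst hj0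
    rw [hf.1, hf'.1]
    simp
  · obtain ⟨k, rfl⟩ : ∃ k, j = k + 1 := ⟨j - 1, by omega⟩
    have hgap := (gap_le_sum_parts hb hmono hB hM hlo hS huniq hh' k 0).1
    have hθ0 : 0 ≤ ∑ k ∈ range K, (k : ℝ) * Λ k := sum_nonneg fun k _ => mul_nonneg (Nat.cast_nonneg k) (hΛ k)
    have hF0 : 0 ≤ F := div_nonneg (mul_nonneg hθ0 hδ) (by linarith)
    have hX : ∀ l, max (1 / h' (0 + l + 1) ^ 2 - 1 / S (h' (0 + l)) 1 ^ 2) 0 ≤ F := fun l =>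
      max_le (by
        have := (dual_steps_above hb hmono hB hM hlo' hle hbdd hS huniq hΛ hθ hτ hθτ hδ hLip hDdef hh' hp hpγ hf' (0 + l)).1
        simpa only [Nat.zero_add, add_zero] using this) hF0
    have hsum : ∑ l ∈ range (k + 1), max (1 / h' (0 + l + 1) ^ 2 - 1 / S (h' (0 + l)) 1 ^ 2) 0 ≤ ((k : ℝ) + 1) * F := by
      have hs := sum_le_sum fun l (_ : l ∈ range (k + 1)) => hX l
      rw [sum_const, card_range, nsmul_eq_mul] at hs
      push_cast at hs
      linarith
    have hgap0 := hgap.trans hsum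
    have hidx1 : h' (0 + 1 + k) = h' (k + 1) := congrArg h' (by omega)
    have hidx2 : S (h' 0) (1 + k) = h (k + 1) := by rw [hf'.1, ← e, Nat.add_comm]
    rw [hidx1] at hgap0
    rw [hidx2] at hgap0
    push_cast
    linarith

/-- **THE SCALE-UNIFORM RATIO FROM BELOW: `h_j∕√(1+κ) ≤ h′_j`, `κ = θδ∕((1−θ)b)`** — same data as `level_surplus_le`; the surplus `j·θδ∕(1−θ)` is at most `κ` times the base level
(`≥ 1∕p² + j·b`). [folklore] -/
theorem coupling_ratio_ge {Λ : ℕ → ℝ} {K : ℕ} {βb p τ δ : ℝ}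
    (hmono : ∀ u v : ℕ → ℝ, SeqBox γ u → SeqBox γ v → (∀ i, u i ≤ v i) → B u ≤ B v)
    (hB : ∀ u u' : ℕ → ℝ, SeqBox γ u → SeqBox γ u' → ∀ D : ℝ, (∀ j, |u j - u' j| ≤ D) → |B u - B u'| ≤ M * D) (hM : 0 ≤ M)
    (hb : 0 < b) (hlo' : ∀ u, SeqBox γ u → b ≤ B' u) (hle : ∀ u, SeqBox γ u → B' u ≤ B u) (hbdd : ∀ u, SeqBox γ u → B u ≤ βb)
    (hΛ : ∀ k, 0 ≤ Λ k) (hθ : ∑ k ∈ range K, (k : ℝ) * Λ k < 1)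
    (hτ : 0 ≤ τ) (hθτ : (1 + τ) * ∑ k ∈ range K, (k : ℝ) * Λ k ≤ 1) (hδ : 0 ≤ δ)
    (hLip : ∀ u v : ℕ → ℝ, SeqBox γ u → SeqBox γ v → (∀ k : ℕ, 1 / γ ^ 2 + ((k : ℝ) + 1) * b ≤ 1 / u k ^ 2) →
      (∀ k : ℕ, 1 / γ ^ 2 + ((k : ℝ) + 1) * b ≤ 1 / v k ^ 2) → B u - B v ≤ ∑ k ∈ range K, Λ k * max (1 / v k ^ 2 - 1 / u k ^ 2) 0)
    (hDdef : ∀ u v : ℕ → ℝ, SeqBox γ u → SeqBox γ v → (∀ i, u i ≤ v i) → B u - B' u ≤ (1 + τ) * (B v - B' v) + δ)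
    (hp : 0 < p) (hpγ : p ≤ γ) (hh : SeqBox γ h) (hf : MemFlow B p h) (hh' : SeqBox γ h') (hf' : MemFlow B' p h') (j : ℕ) :
    h j / Real.sqrt (1 + (∑ k ∈ range K, (k : ℝ) * Λ k) * δ / (1 - ∑ k ∈ range K, (k : ℝ) * Λ k) / b) ≤ h' j := by
  have hsur := level_surplus_le hmono hB hM hb hlo' hle hbdd hΛ hθ hτ hθτ hδ hLip hDdef hp hpγ hh hf hh' hf' j
  have hlo : ∀ u, SeqBox γ u → b ≤ B u := fun u hu => (hlo' u hu).trans (hle u hu)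
  set θ : ℝ := ∑ k ∈ range K, (k : ℝ) * Λ k with hθdef
  set F : ℝ := θ * δ / (1 - θ) with hFdef
  set κ : ℝ := F / b with hκdef
  have hθ0 : 0 ≤ θ := sum_nonneg fun k _ => mul_nonneg (Nat.cast_nonneg k) (hΛ k)
  have hF0 : 0 ≤ F := div_nonneg (mul_nonneg hθ0 hδ) (by linarith)
  have hκ0 : 0 ≤ κ := div_nonneg hF0 hb.le
  have h1κ : 0 < 1 + κ := by linarith
  have hpj : 0 < h j := (hh j).1
  have hpj' : 0 < h' j := (hh' j).1
  -- j·F ≤ κ·(1∕h_j²) from the floor growth of the base level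
  have hgrow := level_ge_pin_add hlo hh hf j
  have hp2 : 0 < 1 / p ^ 2 := by positivity
  have hjF : (j : ℝ) * F ≤ κ * (1 / h j ^ 2) := by
    rw [hκdef, div_mul_eq_mul_div, le_div_iff₀ hb]
    have : (j : ℝ) * b ≤ 1 / h j ^ 2 := by linarith
    nlinarith
  have hlev : 1 / h' j ^ 2 ≤ (1 + κ) * (1 / h j ^ 2) := by linarith
  -- h_j² ≤ (1+κ)·h′_j²
  have hsq : h j ^ 2 ≤ (1 + κ) * h' j ^ 2 := by
    rw [mul_one_div, div_le_div_iff₀ (pow_pos hpj' 2) (pow_pos hpj 2), one_mul] at hlev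
    linarith
  have hs1 : h j ≤ Real.sqrt (1 + κ) * h' j := by
    have e1 : Real.sqrt ((1 + κ) * h' j ^ 2) = Real.sqrt (1 + κ) * h' j := by
      rw [Real.sqrt_mul h1κ.le, Real.sqrt_sq hpj'.le]
    have e2 : Real.sqrt (h j ^ 2) = h j := Real.sqrt_sq hpj.le
    have := Real.sqrt_le_sqrt hsq
    rwa [e1, e2] at this
  rw [div_le_iff₀ (Real.sqrt_pos.mpr h1κ), mul_comm]
  exact hs1

end Summit.QuantumFields.BalabanUV.Beta.EriceRemainderEnclosureHistoryAutonomyComparisonDefectAbove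

end
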